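import Summits.QuantumFields.YangMills.Theorems.BalabanUVNodesN17AtRecord8
import Summits.QuantumFields.YangMills.Theorems.BalabanUVNodesSpineRates
import Literature.MathematicalPhysics.QuantumFieldTheory.Balaban1983to89.Node00.ChartOfRecord

/-!
# BalabanUVNodes ∕ node N17 = NE4 AT THE CHARTED STAGE-8 RECORD `Node00.IsRecordOfRecord₈X` (chair R448: «chart predicate of record =
# `IsRecordOfRecord₈X` ∕ `IsChartOfRecord`»): companion 5's ∀-forms asked ONLY of admissible θ CARRYING THE CHART OF RECORD, what N17 at a charted
# record READS (`2 ≤ N`: the η-rate of def-B's merged β through a NON-ZERO 𝔰𝔲(N) chart; `N = 1`: β ≡ 0 genuinely), the DISPLAYED chart instances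
# (`suChartMap N`, print's Pauli chart at `N = 2`), and the link to cluster K4's stub `YMDAG.UVSplit.S_N17 RRec`

Cell `pub-ymgap`, HUMAN RULING D-0062, seat `pub-ymgap-dag-n17-a` (-a KNIT-BY-NAME), generation 5; companion 7 (§24–§27) of `BalabanUVNodesN17Knit` …
`BalabanUVNodesN17AtRecord8` (p417546, §20–§23).  THEOREMS ONLY; imports companion 5, the route's K4 module `BalabanUVNodesSpineRates` (p418381:
`Datum`, `U3Carriers`, `RateCarriers`, `RateRecordPred`, `N17At`, `S_N17`) and n23-b's NODE 00 chart modules `Node00/Record8Chart` (p418120: `IsSuChart`,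
`Stage8Params.IsChartOfRecord`, `IsRecordOfRecord₈X`, `rho8_ne_zero`, `betaOfRecord₈_eq_zeroHBeta_of_one`, `rechartPauli`, `exists_isRecordOfRecord₈X_window`)
∕ `Node00/ChartOfRecord` (p419544: `suChartMap`, `Stage8Params.rechart`, `IsRecordOfRecord₈R`); modifies nothing; every cited lemma is used BY NAME.

WHY (dag-ref-B READ #235 PIN on companion 5, chair R445 (a1)∕(a2) → R448): over the UNCHARTED predicate `IsRecordOfRecord₈C` the ∃-form «some Stage-8 record
satisfies N17» is inhabited by the ZERO-CHART junk (`…N17AtRecord8.exists_isRecordOfRecord₈C_N17`: `ρ8 = 0 ⇒ βfun = 0 ⇒ N17` with every constant); the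
countable shapes are (i) the ∀-form over the admissible witnesses WITH the chart displayed, or (ii) any form stated after the chart clause of record
`Stage8Params.IsChartOfRecord θ c` (`IsSuChart N θ.ρ8 θ.bV c`: values in 𝔰𝔲(N), onto, `hsForm`-orthogonal basis of squared norms `c > 0`) has entered the
predicate — `IsRecordOfRecord₈X` (R448 (1)).  THIS FILE states N17's record faces over ₈X.
* §24 THE ∀-FORMS OVER ₈X: `N17_of_isRecordOfRecord₈X` (the merged-β rate on the world's window asked ONLY of admissible θ with `0 < c ∧ θ.IsChartOfRecord c`
  realising `D`), `N17_of_isRecordOfRecord₈X_of_forall₈C` (companion 5's ₈C ∀-form suffices — refinement `isRecordOfRecord₈C_of_isRecordOfRecord₈X`),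
  `N17_of_isRecordOfRecord₈X_rates` (split road «β⁰ conv + β¹ shift»), **`N17_of_isRecordOfRecord₈X_kernelStepRate`** (KERNEL CURRENCY: (UD) + the
  history-matched step rate of the record's OWN limiting polarisation kernels `Node00.polLimit`, asked of charted θ — rows NE2∕NE3∕NE5 in the record's
  letters; the content form), `u2Inputs_of_isRecordOfRecord₈X` (node U2's triple — the N17 → N27 edge's input).
* §25 WHAT N17 AT A CHARTED RECORD READS: **`exists_chart_scaleShiftRate_of_N17`** (`2 ≤ N`: `NE4OnData D c ρ w.γ` at a ₈X record IS the η-rate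
  `ScaleShiftRate c ρ w.γ` of def-B's merged β `betaMerged F (mergedTermFamilyMat …) θ.ρ8 θ.bV` through a chart of record with `θ.ρ8 ≠ 0` — no zero-chart
  reading is available: `IsChartOfRecord.rho8_ne_zero`); `N17_of_isRecordOfRecord₈X_one` ∕ `exists_isRecordOfRecord₈X_N17_one` (`N = 1`: 𝔰𝔲(1) = 0, the β of
  record VANISHES at every chart of record — `betaOfRecord₈_eq_zeroHBeta_of_one` — so N17 holds with every `c, ρ ≥ 0`: the trivial theory, said as such; for
  `2 ≤ N` an N17-at-₈X inhabitant IS an η-rate theorem for Bałaban's β — none is claimed).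
* §26 THE DISPLAYED CHART INSTANCES (R445 (a2)): `N17_datumOfRecord₈_rechart_iff` (every `N`: at the datum of `θ.rechart`, N17 ↔ the η-rate of the merged β
  read through THE CHART OF RECORD `suChartMap N` and the standard basis), `N17_datumOfRecord₈_rechartPauli_iff` (`N = 2`, print's Pauli chart
  `pauliChart`, [Balaban1985UV3] p. 260), `N17_of_isRecordOfRecord₈R` (the ∀-form over the predicate CHARTED BY DEFINITION `IsRecordOfRecord₈R` — no chart
  quantifier: the merged-β rate through `suChartMap N` asked of every admissible θ realising `D`).
* §27 THE LINK TO CLUSTER K4 (module 2): `n17At_datumOfRecord₈_iff_merged` (`N17At (datumOfRecord₅ …) u ↔` the merged-β rate at the carriers' DEPENDENT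
  letters `(u.cr·u.C₅·u.θ, u.ρ, u.γ)`, box `u.γ ≤ θ.γ`), **`s_N17_of_charted_slot`** (`S_N17 RRec` for EVERY rate-record predicate whose bundles of record come
  with a CHARTED admissible Stage-8 witness realising the datum, `R.u3.γ ≤ θ.γ`, and the merged-β rate at `R.u3`'s letters — the (W2) closer an `RRec` home
  reading the ₈X record applies once), `s_N17_of_shadow` (the (W2′) rider: `S_N17` transfers along any shadow map of bundles preserving `D.βfun` and `R.u3` —
  the Stage-9 ∕ tower-datum re-keying shape, by companion-6-style `βfun`-congruence).

HONEST FRAMING.  Kernel bookkeeping BY NAME over definition-level predicates; 0 sorry; NE4 NOT IN PRINT ([Balaban1987RG1] (1.20)–(1.22) p. 264: linearity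
in the LAST coupling only) and NOT PROVED; every rate input is a displayed HYPOTHESIS (rows NE2∕NE3∕NE5 through (1.22), (UD) = (5.10) p. 293 printed for
Bałaban's kernels but a hypothesis here); the ₈X inhabitants of record are the zero-chart θ RE-CHARTED with Stage 0–5 carriers DEGENERATE as labelled (R448 (2));
nothing of Bałaban's asserted; N17 NOT discharged; «A: n∕28» unmoved.  One finite four-torus at fixed ε per run — NOT infinite volume, NOT OS on ℝ⁴, NOT a
mass gap, NOT Clay.
-/

noncomputable section

open scoped Matrix.Norms.L2Operator

namespace Summit.QuantumFields.YangMills.Theorems.BalabanUVNodesN17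

open Filter Topology
open Literature.MathematicalPhysics.QuantumFieldTheory.Balaban1983to89
open Literature.MathematicalPhysics.QuantumFieldTheory.Balaban1983to89.FlowStep
open Literature.MathematicalPhysics.QuantumFieldTheory.Balaban1983to89.T4CouplingMatching
open Literature.MathematicalPhysics.QuantumFieldTheory.Balaban1983to89.T4Continuum (T4Family FiniteEpsData ULoop)
open Literature.MathematicalPhysics.QuantumFieldTheory.Balaban1983to89.T4FlagMemory (tail_mem_box)
open Literature.MathematicalPhysics.QuantumFieldTheory.Balaban1983to89.B12Sec2to5 (Decay510 betaPrime510)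
open Literature.MathematicalPhysics.QuantumFieldTheory.Balaban1983to89.Beta.LimitRate (subKernel subKernel_apply)
open Literature.MathematicalPhysics.QuantumFieldTheory.Balaban1983to89.Node00
open Literature.MathematicalPhysics.QuantumFieldTheory.Balaban1983to89.T4FiniteEpsInhabited (zeroHBeta)
open Literature.MathematicalPhysics.QuantumFieldTheory.Balaban1983to89.DagBinding (WorldP)
open Summit.QuantumFields.BalabanUV.T4Continuum.Spine.NE4 (NE4OnData U2Inputs ne4OnData_iff)
open YMDAG.UVSplit (Datum U3Carriers RateCarriers RateRecordPred N17At S_N17)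

/-! ## §24 N17 AT THE CHARTED STAGE-8 RECORD `IsRecordOfRecord₈X F N D w` — ∀-forms asked only of admissible θ CARRYING THE CHART OF RECORD -/

section Charted
variable {F : T4Family} {N : ℕ} [NeZero N]

/-- **N17 AT A CHARTED STAGE-8 RECORD `(D, w)`.**  If at EVERY admissible Stage-8 parameter CARRYING A CHART OF RECORD (`0 < c`, `θ.IsChartOfRecord c`) whose
datum is `D` and whose record box contains the world's window the merged β of record satisfies `ScaleShiftRate cN ρ w.γ`, then `NE4OnData D cN ρ w.γ` — the
chart clause, the box side `w.γ ≤ θ.γ` and its positivity being CLAUSES of `IsRecordOfRecord₈X` (chair R448 (1)).  Hypothesis displayed, not asserted.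
[cite: Balaban1987RG1, (1.20)-(1.22) p.264; Balaban1989LargeFieldII, Thm 1 p.355] -/
theorem N17_of_isRecordOfRecord₈X {D : Datum F N} {w : WorldP} (h : IsRecordOfRecord₈X F N D w) {cN ρ : ℝ}
    (hin : ∀ (θ : Stage8Params F N) (c : ℝ), θ.Admissible → 0 < c → θ.IsChartOfRecord c →
      D = datumOfRecord₅ F N (θ.toStage5 F N) → w.γ ≤ θ.γ →
      letI := θ.instVβ₁; letI := θ.instVβ₂; letI := θ.instιβ
      ScaleShiftRate cN ρ w.γ (betaMerged F (mergedTermFamilyMat F N (chi7 F N θ) θ.εbg) θ.ρ8 θ.bV)) :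
    NE4OnData D cN ρ w.γ := by
  obtain ⟨θ, c, hθ, hc, hch, hD, -, ⟨-, hγle⟩, -, -⟩ := h
  have hm := hin θ c hθ hc hch hD hγle
  subst hD
  exact (N17_datumOfRecord₈_iff_merged θ hγle).mpr hm

/-- **THE UNCHARTED ∀-FORM SUFFICES** [bookkeeping]: companion 5's hypothesis (asked of every admissible θ, chart or not) gives N17 at every ₈X record —
refinement `isRecordOfRecord₈C_of_isRecordOfRecord₈X` + `N17_of_isRecordOfRecord₈C`. [cite: Balaban1987RG1, (1.20)-(1.22) p.264] -/
theorem N17_of_isRecordOfRecord₈X_of_forall₈C {D : Datum F N} {w : WorldP} (h : IsRecordOfRecord₈X F N D w) {cN ρ : ℝ}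
    (hin : ∀ θ : Stage8Params F N, θ.Admissible → D = datumOfRecord₅ F N (θ.toStage5 F N) → w.γ ≤ θ.γ →
      letI := θ.instVβ₁; letI := θ.instVβ₂; letI := θ.instιβ
      ScaleShiftRate cN ρ w.γ (betaMerged F (mergedTermFamilyMat F N (chi7 F N θ) θ.εbg) θ.ρ8 θ.bV)) :
    NE4OnData D cN ρ w.γ :=
  N17_of_isRecordOfRecord₈C (isRecordOfRecord₈C_of_isRecordOfRecord₈X h) hin

/-- **N17 AT A CHARTED RECORD BY THE SPLIT ROAD** («β⁰ conv + β¹ shift»): (AF-0r) for `beta0OfMerged βm₈ θ.v₀` (constant `c₀ ≥ 0`) ∧ the merged remainder's rate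
(constant `c₁`) on the world's window, asked of every CHARTED admissible witness, `0 ≤ ρ ≤ 1` ⟹ `NE4OnData D (2c₀ + c₁) ρ w.γ`.  Both binders UNPRINTED.
[cite: Balaban1987RG1, (2.12)-(2.14) p.268] -/
theorem N17_of_isRecordOfRecord₈X_rates {D : Datum F N} {w : WorldP} (h : IsRecordOfRecord₈X F N D w) {c₀ c₁ ρ : ℝ}
    (hρ0 : 0 ≤ ρ) (hρ1 : ρ ≤ 1) (hc₀ : 0 ≤ c₀)
    (hin : ∀ (θ : Stage8Params F N) (c : ℝ), θ.Admissible → 0 < c → θ.IsChartOfRecord c →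
      D = datumOfRecord₅ F N (θ.toStage5 F N) → w.γ ≤ θ.γ →
      letI := θ.instVβ₁; letI := θ.instVβ₂; letI := θ.instιβ
      ∃ binf : ℝ,
        (∀ k, |beta0OfMerged (betaMerged F (mergedTermFamilyMat F N (chi7 F N θ) θ.εbg) θ.ρ8 θ.bV) θ.v₀ k - binf| ≤ c₀ * ρ ^ k) ∧
        ScaleShiftRate c₁ ρ w.γ fun k v =>
          betaMerged F (mergedTermFamilyMat F N (chi7 F N θ) θ.εbg) θ.ρ8 θ.bV k v -
            beta0OfMerged (betaMerged F (mergedTermFamilyMat F N (chi7 F N θ) θ.εbg) θ.ρ8 θ.bV) θ.v₀ k) :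
    NE4OnData D (2 * c₀ + c₁) ρ w.γ := by
  obtain ⟨θ, c, hθ, hc, hch, hD, -, ⟨-, hγle⟩, -, -⟩ := h
  obtain ⟨binf, hconv, hrem⟩ := hin θ c hθ hc hch hD hγle
  subst hD
  exact N17_datumOfRecord₈_of_rates θ hγle hρ0 hρ1 hc₀ hconv hrem

/-- **N17 AT A CHARTED RECORD IN KERNEL CURRENCY — the content form.**  (UD) ((5.10)-decay, some `C`, `δ > 0` per witness) ∧ the HISTORY-MATCHED STEP RATE
`|Π_{k+2}(w; x) − Π_{k+1}(tail w; x)| ≤ C′ρ^k e^{−δ′|x|₁}` (fixed `C′`, `δ′ > 0`) of the record's OWN limiting polarisation kernels `Node00.polLimit` read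
through θ's chart `(θ.ρ8, θ.bV)`, on the world's window, asked of every CHARTED admissible witness ⟹ `NE4OnData D (β′(C′,δ′)) ρ w.γ`
(companion 4 `scaleShiftRate_betaMerged_of_kernelStepRate`).  For `2 ≤ N` the chart asked about is NON-ZERO (`IsChartOfRecord.rho8_ne_zero`) — the junk
instance of companion 5 §23 (`kernelStepRate_datumOfRecord₈_of_zeroChart`) does not occur.  (UD) is PRINTED for Bałaban's kernels, the step rate is NOT
(rows NE2∕NE3∕NE5 = N15∕N16∕N18 in the record's letters). [cite: Balaban1987RG1, (1.21)-(1.22) p.264 and (5.10) p.293] -/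
theorem N17_of_isRecordOfRecord₈X_kernelStepRate {D : Datum F N} {w : WorldP} (h : IsRecordOfRecord₈X F N D w) {C' δ' ρ : ℝ}
    (hδ' : 0 < δ')
    (hin : ∀ (θ : Stage8Params F N) (c : ℝ), θ.Admissible → 0 < c → θ.IsChartOfRecord c →
      D = datumOfRecord₅ F N (θ.toStage5 F N) → w.γ ≤ θ.γ →
      letI := θ.instVβ₁; letI := θ.instVβ₂; letI := θ.instιβ
      (∃ C δ : ℝ, 0 < δ ∧ ∀ k (v : Fin (k + 1) → ℝ), v ∈ Box w.γ k →
        Decay510 (polLimit F (k + 1) (fun K => mergedTermFamilyMat F N (chi7 F N θ) θ.εbg k v K) θ.ρ8 θ.bV 0 1) C δ) ∧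
      (∀ k (u : Fin (k + 2) → ℝ), u ∈ Box w.γ (k + 1) →
        Decay510 (subKernel (polLimit F (k + 1 + 1) (fun K => mergedTermFamilyMat F N (chi7 F N θ) θ.εbg (k + 1) u K) θ.ρ8 θ.bV)
          (polLimit F (k + 1) (fun K => mergedTermFamilyMat F N (chi7 F N θ) θ.εbg k (Fin.tail u) K) θ.ρ8 θ.bV) 0 1) (C' * ρ ^ k) δ')) :
    NE4OnData D (betaPrime510 4 C' δ') ρ w.γ := by
  obtain ⟨θ, c, hθ, hc, hch, hD, -, ⟨-, hγle⟩, -, -⟩ := h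
  obtain ⟨⟨C, δ, hδ, hU⟩, hS⟩ := hin θ c hθ hc hch hD hγle
  subst hD
  letI := θ.instVβ₁; letI := θ.instVβ₂; letI := θ.instιβ
  exact (N17_datumOfRecord₈_iff_merged θ hγle).mpr
    (scaleShiftRate_betaMerged_of_kernelStepRate F (mergedTermFamilyMat F N (chi7 F N θ) θ.εbg) θ.ρ8 θ.bV hδ hδ' hU hS)

/-- **NODE U2's INPUT TRIPLE AT A CHARTED RECORD** (the N17 → N27 edge's input): N17 ∧ the history moduli OF THE MERGED β on the world's window, asked of every
CHARTED admissible witness, ∧ the β-free fading-memory clause ⟹ `U2Inputs D cN C ρ w.γ Λ`. [cite: Balaban1987RG1, §5 p.298] -/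
theorem u2Inputs_of_isRecordOfRecord₈X {D : Datum F N} {w : WorldP} (h : IsRecordOfRecord₈X F N D w) {cN C ρ : ℝ}
    {Λ : ℕ → ℕ → ℝ} (hF : FadingMemory C ρ Λ)
    (hin : ∀ (θ : Stage8Params F N) (c : ℝ), θ.Admissible → 0 < c → θ.IsChartOfRecord c →
      D = datumOfRecord₅ F N (θ.toStage5 F N) → w.γ ≤ θ.γ →
      letI := θ.instVβ₁; letI := θ.instVβ₂; letI := θ.instιβ
      ScaleShiftRate cN ρ w.γ (betaMerged F (mergedTermFamilyMat F N (chi7 F N θ) θ.εbg) θ.ρ8 θ.bV) ∧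
        HistLipschitz Λ w.γ (betaMerged F (mergedTermFamilyMat F N (chi7 F N θ) θ.εbg) θ.ρ8 θ.bV)) :
    U2Inputs D cN C ρ w.γ Λ := by
  obtain ⟨θ, c, hθ, hc, hch, hD, -, ⟨-, hγle⟩, -, -⟩ := h
  obtain ⟨hm, hL⟩ := hin θ c hθ hc hch hD hγle
  subst hD
  exact (u2Inputs_datumOfRecord₈_iff θ hγle).mpr ⟨hm, hL, hF⟩

/-! ## §25 WHAT N17 AT A CHARTED RECORD READS — `2 ≤ N`: the η-rate of the merged β through a NON-ZERO 𝔰𝔲(N) chart; `N = 1`: β ≡ 0 genuinely -/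

/-- **`2 ≤ N`: N17 AT A ₈X RECORD IS AN η-RATE STATEMENT ABOUT def-B's MERGED β THROUGH A GENUINE CHART** (kernel): from `IsRecordOfRecord₈X F N D w` and
`NE4OnData D c ρ w.γ` one obtains an admissible witness θ with normalisation `cβ > 0`, `θ.IsChartOfRecord cβ`, `θ.ρ8 ≠ 0` (`Record8Chart.exists_chart_of_…`),
`w.γ ≤ θ.γ`, `D` its datum, AND `ScaleShiftRate c ρ w.γ (betaMerged F (mergedTermFamilyMat F N (chi7 F N θ) θ.εbg) θ.ρ8 θ.bV)` — companion 5's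
`N17_datumOfRecord₈_iff_merged` forward.  The zero-chart reading of companion 5 §23 is EXCLUDED here (R448 (1)). [cite: Balaban1987RG1, (1.20)-(1.22) p.264] -/
theorem exists_chart_scaleShiftRate_of_N17 {D : Datum F N} {w : WorldP} (h : IsRecordOfRecord₈X F N D w) (hN : 2 ≤ N) {c ρ : ℝ}
    (hN17 : NE4OnData D c ρ w.γ) :
    ∃ (θ : Stage8Params F N) (cβ : ℝ), θ.Admissible ∧ 0 < cβ ∧ θ.IsChartOfRecord cβ ∧
      (letI := θ.instVβ₁; letI := θ.instVβ₂; θ.ρ8) ≠ 0 ∧ w.γ ≤ θ.γ ∧ D = datumOfRecord₅ F N (θ.toStage5 F N) ∧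
      letI := θ.instVβ₁; letI := θ.instVβ₂; letI := θ.instιβ
      ScaleShiftRate c ρ w.γ (betaMerged F (mergedTermFamilyMat F N (chi7 F N θ) θ.εbg) θ.ρ8 θ.bV) := by
  obtain ⟨θ, cβ, hθ, hc, hch, hD, -, hρ8, -, hγle⟩ := exists_chart_of_isRecordOfRecord₈X h hN
  refine ⟨θ, cβ, hθ, hc, hch, hρ8, hγle, hD, ?_⟩
  subst hD
  exact (N17_datumOfRecord₈_iff_merged θ hγle).mp hN17

/-- **`N = 1`: N17 HOLDS AT EVERY ₈X RECORD OVER SU(1) WITH EVERY CONSTANT** — GENUINELY, not by junk: 𝔰𝔲(1) = 0, so the chart of record IS the zero chart and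
the Stage-8 β of record vanishes identically (`IsChartOfRecord.betaOfRecord₈_eq_zeroHBeta_of_one`); hence `NE4OnData D c ρ γ'` for all `c, ρ ≥ 0` on every box.
The trivial theory, said as such; the route's cruxes sit at `N = 2`. [cite: Balaban1987RG1, (1.20)-(1.22) p.264 (bookkeeping at N = 1)] -/
theorem N17_of_isRecordOfRecord₈X_one {F : T4Family} {D : Datum F 1} {w : WorldP} (h : IsRecordOfRecord₈X F 1 D w)
    {c ρ : ℝ} (γ' : ℝ) (hc : 0 ≤ c) (hρ : 0 ≤ ρ) : NE4OnData D c ρ γ' := by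
  obtain ⟨θ, cβ, -, -, hch, hD, -⟩ := h
  subst hD
  rw [ne4OnData_iff, βfun_stage8, hch.betaOfRecord₈_eq_zeroHBeta_of_one]
  intro k w _
  show |(0 : ℝ) - 0| ≤ c * ρ ^ k
  rw [sub_zero, abs_zero]
  exact mul_nonneg hc (pow_nonneg hρ k)

/-- **INHABITED-AT-₈X FOR THE N17 FACE — AT `N = 1` ONLY** [bookkeeping]: for every four-torus family, any record box `γ` and window `0 < γw ≤ γ`, a charted
Stage-8 record over SU(1) exists (`Record8Chart.exists_isRecordOfRecord₈X_window`) and N17 holds there with every constant (`N17_of_isRecordOfRecord₈X_one`).  For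
`2 ≤ N` NO inhabitant of «₈X record ∧ N17» is claimed: by `exists_chart_scaleShiftRate_of_N17` such an inhabitant IS an η-rate theorem for Bałaban's merged β
through a non-zero chart — the node's content, discharged by nobody here. [cite: Balaban1987RG1, (1.20)-(1.22) p.264 (bookkeeping witness at N = 1)] -/
theorem exists_isRecordOfRecord₈X_N17_one (F : T4Family) {γ γw : ℝ} (h0 : 0 < γw) (hle : γw ≤ γ) :
    ∃ (D : Datum F 1) (w : WorldP), IsRecordOfRecord₈X F 1 D w ∧ w.γ = γw ∧
      ∀ (c ρ γ' : ℝ), 0 ≤ c → 0 ≤ ρ → NE4OnData D c ρ γ' := by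
  obtain ⟨D, w, hX, hw⟩ := exists_isRecordOfRecord₈X_window F 1 (γ := γ) h0 hle
  exact ⟨D, w, hX, hw, fun c ρ γ' hc hρ => N17_of_isRecordOfRecord₈X_one hX γ' hc hρ⟩

/-! ## §26 THE DISPLAYED CHART INSTANCES (R445 (a2)): the chart of record `suChartMap N` (every `N`), print's Pauli chart (`N = 2`), the ₈R predicate -/

/-- **N17 AT THE DATUM OF A RE-CHARTED PARAMETER `θ.rechart` (every `N`)**: on a box side `γ' ≤ θ.γ`, `NE4OnData D₀ c ρ γ'` ↔ the η-rate of def-B's merged β READ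
THROUGH THE CHART OF RECORD — `betaMerged F (mergedTermFamilyMat F N (chi7 F N θ) θ.εbg) (suChartMap N) (Pi.basisFun ℝ _)` (ChartOfRecord's
`betaOfRecord₈_rechart` display; companion 5 `N17_datumOfRecord₈_iff_merged` at `θ.rechart`, `rfl` on the re-charted fields).  The DISPLAYED non-degenerate chart
instance of the N17 row (`suChartMap_ne_zero` for `2 ≤ N`). [cite: Balaban1987RG1, (1.20)-(1.22) p.264] -/
theorem N17_datumOfRecord₈_rechart_iff (θ : Stage8Params F N) {c ρ γ' : ℝ} (hγ : γ' ≤ θ.γ) :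
    NE4OnData (datumOfRecord₅ F N (θ.rechart.toStage5 F N)) c ρ γ' ↔
      ScaleShiftRate c ρ γ'
        (betaMerged F (mergedTermFamilyMat F N (chi7 F N θ) θ.εbg) (suChartMap N) (Pi.basisFun ℝ (Fin (suChartDim N)))) :=
  N17_datumOfRecord₈_iff_merged θ.rechart hγ

/-- **`N = 2`: N17 AT THE DATUM RE-CHARTED BY PRINT'S PAULI CHART** `x ↦ iΣ_a x_aσ_a` ([Balaban1985UV3] p. 260; `Record8Chart.pauliChart`, `c = 2`): on `γ' ≤ θ.γ`,
`NE4OnData D₀ c ρ γ'` ↔ the η-rate of the merged β read through `pauliChart` and the standard basis of ℝ³. [cite: Balaban1985UV3, p.260; Balaban1987RG1, (1.20)-(1.22) p.264] -/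
theorem N17_datumOfRecord₈_rechartPauli_iff {F : T4Family} (θ : Stage8Params F 2) {c ρ γ' : ℝ} (hγ : γ' ≤ θ.γ) :
    NE4OnData (datumOfRecord₅ F 2 (θ.rechartPauli.toStage5 F 2)) c ρ γ' ↔
      ScaleShiftRate c ρ γ' (betaMerged F (mergedTermFamilyMat F 2 (chi7 F 2 θ) θ.εbg) pauliChart (Pi.basisFun ℝ (Fin 3))) :=
  N17_datumOfRecord₈_iff_merged θ.rechartPauli hγ

/-- **N17 AT THE PREDICATE CHARTED BY DEFINITION `IsRecordOfRecord₈R`** (ChartOfRecord §3, «pins, not guards»; refines ₈X): if at every admissible θ whose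
RE-CHARTED datum is `D` and whose record box contains the window the merged β read through `suChartMap N` has the rate, then `NE4OnData D c ρ w.γ` — NO chart is
quantified over. [cite: Balaban1987RG1, (1.20)-(1.22) p.264; Balaban1989LargeFieldII, Thm 1 p.355] -/
theorem N17_of_isRecordOfRecord₈R {D : Datum F N} {w : WorldP} (h : IsRecordOfRecord₈R F N D w) {c ρ : ℝ}
    (hin : ∀ θ : Stage8Params F N, θ.Admissible → D = datumOfRecord₅ F N (θ.rechart.toStage5 F N) → w.γ ≤ θ.γ →
      ScaleShiftRate c ρ w.γ
        (betaMerged F (mergedTermFamilyMat F N (chi7 F N θ) θ.εbg) (suChartMap N) (Pi.basisFun ℝ (Fin (suChartDim N))))) :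
    NE4OnData D c ρ w.γ := by
  obtain ⟨θ, hθ, hD, -, ⟨-, hγle⟩, -, -⟩ := h
  have hm := hin θ hθ hD hγle
  subst hD
  exact (N17_datumOfRecord₈_rechart_iff θ hγle).mpr hm

end Charted

/-! ## §27 THE LINK TO CLUSTER K4's STUB `YMDAG.UVSplit.S_N17 RRec` (route module 2 `BalabanUVNodesSpineRates`) -/

section K4Link
variable {F : T4Family} {N : ℕ} [NeZero N]

/-- **`N17At` AT A STAGE-8 DATUM READS THE MERGED β AT THE CARRIERS' DEPENDENT LETTERS** [bookkeeping]: for `u.γ ≤ θ.γ`,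
`N17At (datumOfRecord₅ F N (θ.toStage5 F N)) u ↔ ScaleShiftRate (u.cr·u.C₅·u.θ) u.ρ u.γ βm₈` (module 2's `N17At` = `NE4OnData` at `(cr·C₅·θ, ρ, γ)`; companion 5
`N17_datumOfRecord₈_iff_merged`). [cite: Balaban1987RG1, (1.20)-(1.22) p.264] -/
theorem n17At_datumOfRecord₈_iff_merged (θ : Stage8Params F N) (u : U3Carriers) (hγ : u.γ ≤ θ.γ) :
    N17At (datumOfRecord₅ F N (θ.toStage5 F N)) u ↔
      letI := θ.instVβ₁; letI := θ.instVβ₂; letI := θ.instιβ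
      ScaleShiftRate (u.cr * u.C₅ * u.θ) u.ρ u.γ (betaMerged F (mergedTermFamilyMat F N (chi7 F N θ) θ.εbg) θ.ρ8 θ.bV) :=
  N17_datumOfRecord₈_iff_merged θ hγ

/-- **(W2) CLOSER — `S_N17 RRec` FOR EVERY RATE RECORD READING THE CHARTED STAGE-8 RECORD WITH THE RATE** (kernel): if every bundle `R` of record for
`(F, D, g₀, os)` comes with a CHARTED admissible Stage-8 witness (`0 < c`, `θ.IsChartOfRecord c`) realising `D`, with `R.u3.γ ≤ θ.γ`, at which the merged β of record
has the η-rate at `R.u3`'s dependent letters, then `S_N17 RRec`.  An `RRec` home whose clause list carries this slot closes the K4 stub by ONE application; the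
chart conjunct is displayed (not used by the implication) so that the slot is R448-countable. [cite: Balaban1987RG1, (1.20)-(1.22) p.264] -/
theorem s_N17_of_charted_slot (RRec : RateRecordPred N)
    (hslot : ∀ (F : T4Family) (D : Datum F N) (g₀ : ℕ → ℝ) (os : List (ULoop F)) (R : RateCarriers N), RRec F D g₀ os R →
      ∃ (θ : Stage8Params F N) (c : ℝ), θ.Admissible ∧ 0 < c ∧ θ.IsChartOfRecord c ∧
        D = datumOfRecord₅ F N (θ.toStage5 F N) ∧ R.u3.γ ≤ θ.γ ∧
        letI := θ.instVβ₁; letI := θ.instVβ₂; letI := θ.instιβ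
        ScaleShiftRate (R.u3.cr * R.u3.C₅ * R.u3.θ) R.u3.ρ R.u3.γ
          (betaMerged F (mergedTermFamilyMat F N (chi7 F N θ) θ.εbg) θ.ρ8 θ.bV)) :
    S_N17 RRec := by
  intro F D g₀ os R hR
  obtain ⟨θ, c, -, -, -, hD, hγ, hm⟩ := hslot F D g₀ os R hR
  subst hD
  exact (n17At_datumOfRecord₈_iff_merged θ R.u3 hγ).mpr hm

/-- **(W2′) RIDER — `S_N17` TRANSFERS ALONG SHADOWS PRESERVING `βfun` AND THE U3 CARRIERS** [bookkeeping]: if every bundle of record `(F, D, g₀, os, R)` for `RRec`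
has a shadow bundle `(F′, D′, g₀′, os′, R′)` of record for `RRec₀` with `D′.βfun = D.βfun` and `R′.u3 = R.u3`, then `S_N17 RRec₀ → S_N17 RRec` — N17 reads the
datum only through its β-family (the Stage-9 ∕ tower-datum re-keying shape: def-T's `Record9` shadows, n23-a's adapter). [folklore] -/
theorem s_N17_of_shadow {RRec₀ RRec : RateRecordPred N} (h₀ : S_N17 RRec₀)
    (hsh : ∀ (F : T4Family) (D : Datum F N) (g₀ : ℕ → ℝ) (os : List (ULoop F)) (R : RateCarriers N), RRec F D g₀ os R →
      ∃ (F' : T4Family) (D' : Datum F' N) (g₀' : ℕ → ℝ) (os' : List (ULoop F')) (R' : RateCarriers N),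
        RRec₀ F' D' g₀' os' R' ∧ D'.βfun = D.βfun ∧ R'.u3 = R.u3) :
    S_N17 RRec := by
  intro F D g₀ os R hR
  obtain ⟨F', D', g₀', os', R', hR', hβ, hu⟩ := hsh F D g₀ os R hR
  have h := h₀ F' D' g₀' os' R' hR'
  rw [hu] at h
  intro k w hw
  have hk := h k w hw
  rwa [hβ] at hk

end K4Link

end Summit.QuantumFields.YangMills.Theorems.BalabanUVNodesN17

end
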